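import Summits.CriticalPhenomena.PercolationContinuityZ3.Theorems.Transplant.SkelFrmQuasi1ChoiceDefsPx
import Summits.CriticalPhenomena.PercolationContinuityZ3.Theorems.Transplant.SkelFrmQuasi1ClosureLTKPx
import Summits.CriticalPhenomena.PercolationContinuityZ3.Theorems.Transplant.PlanarSkeletonFrmQuasiReflect
import Summits.CriticalPhenomena.PercolationContinuityZ3.Theorems.Transplant.SkelFrmFrom1ChoiceLTKPx
import Summits.CriticalPhenomena.PercolationContinuityZ3.Theorems.Transplant.PlanarSkeletonFrmQuasiDefs
import Summits.CriticalPhenomena.PercolationContinuityZ3.Theorems.Transplant.PlanarSkeletonFrmQuasiProxies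
import Summits.CriticalPhenomena.PercolationContinuityZ3.Theorems.Transplant.SkelFrmQuasi1ChoiceDefs
import Summits.CriticalPhenomena.PercolationContinuityZ3.Theorems.Transplant.SkelFrmQuasi1NormalisePx
import HarnessLib

/-!
# GEN-Q PORT (WAVE-Q table v0.8 section 2, row G242, U-level ?; captain R-6/R-7 2026-08-27: carrier token swap `PlanarSkeletonFrmFrom ↦ PlanarSkeletonFrmQuasi`)
# of the tree module «Transplant/SkelFrmFrom1ChoiceLTKPx» (sha256 b6457e246e711294…) onto the quasi-step carrier `PlanarSkeletonFrmQuasi` (p507026): «SkelFrmQuasi1ChoiceLTKPx»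

ORIGINAL TITLE: 

builds on p205010 (kernel theorem, internal audit signed; external expert review pending) — nothing in this file uses p205010; NOTHING is claimed about any open node
((N3-b), the end state).  Lane `prim-bschramm`, seat `prim-bschramm-gen-1` (gen 4; binder-wave captain).  Helper file (`--supports stmt-CriticalPhenomena-4575 --as helper`).
PORT RULES (U-wave r1–r4 re-used, GEN-Q hunk classes of p3-g29 #6136): declaration order, names and proof texts are those of «SkelFrmFrom1ChoiceLTKPx», byte-identical except
(i) the carrier token `PlanarSkeletonFrmFrom ↦ PlanarSkeletonFrmQuasi` in binders, `namespace`/`end` lines and qualified names (module names `SkelFrmFrom… ↦ SkelFrmQuasi…`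
in imports of already-ported rows); (ii) `Φ.step ↦ Φ.qstep` with the called Steps lemma replaced by its `…Q`/`_q` twin and the cost `Φ.M` threaded (none in this file unless
listed below); (iii) `Φ.cyl_connected ↦ Φ.cyl_reach` readers (none unless listed); (iv) graph-ball radii / window floors ×`Φ.M` (none unless listed).  Carrier-free
residents stay imported/exported from the original «SkelFrm1ChoiceLTKPx» exactly as in the FrmFrom port.  Docstrings and citations are the original's.

-/

noncomputable section

open MeasureTheory ProbabilityTheory
open scoped ENNReal Classical

namespace Summit.CriticalPhenomena.PercolationContinuityZ3.Theorems.Transplant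

open Literature.Probability.Percolation Literature.Probability.LatticeModels SimpleGraph KNCells KNLevels
open Literature.Barriers.CriticalPhenomena (HasExponentialGrowth graphBall)
open SkelConc (Consts)

/-! ## §1 Two transports -/

namespace Skelφ.StepI

variable {V : Type} {G : SimpleGraph V}

-- GEN-Q: carrier-free resident `Skelφ.StepI.OutNS.FactsNS.of_le` lives in the FrmFrom module (same namespace) — not re-declared.

end Skelφ.StepI

namespace PlanarSkeletonFrmQuasi

export PlanarSkeletonFrm (ChainFactQT)  -- T3-auto: resident alias replicated from the FrmFrom namespace
export PlanarSkeletonFrm (FlatQ)  -- T3-auto: resident alias replicated from the FrmFrom namespace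
export PlanarSkeletonFrmFrom (samePDropOfSkeletonFrmFrom₁_of_choiceFnNQLTK)  -- T3-auto: resident alias replicated from the FrmFrom namespace

variable {V : Type} {G : SimpleGraph V} [G.LocallyFinite]

/-- **Proxies survive the coordinate reflections**: `Φ.HasProxies t D → (Φ.reflect s).HasProxies t D` — the same automorphism and the same proxy serve, because the reflected
chart `w ↦ (sᵢ φᵢ w)ᵢ` is coordinatewise linear in `φ` (so chart translations stay chart translations and equal positions stay equal) and the graph is unchanged. [folklore] -/
theorem HasProxies.reflect {Φ : PlanarSkeletonFrmQuasi G} {t : V} {D : ℕ} (h : Φ.HasProxies t D) (s : Fin 2 → ℤˣ) : (Φ.reflect s).HasProxies t D := by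
  intro c
  obtain ⟨c', α, hαt, hφ, hcell, hball⟩ := h c
  refine ⟨c', α, hαt, fun w => ?_, ?_, hball⟩
  · funext i
    simp only [reflect_φ, Pi.add_apply, Pi.sub_apply, hφ w]
    ring
  · funext i
    simp only [reflect_φ, hcell]

/-! ## §2 The GEN closure top -/

/-- **THE GEN PARTIAL CLOSURE OF RECORD, pointwise, shared-choice form, face target accuracy `dT`, K-floor `Kmin`** (GEN twin of
`samePDropOfSkeletonFrmFrom₁_of_choiceFnNQLTK`).  Let `𝒞₀` be a GEN choice function at proxy radius `D` (`ChoiceFnNQPxAt D`: over every frames-only skeleton not of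
exponential growth, at a base vertex WITH PROXIES at radius `D`) meeting the geometric obligation `GeomHoldsNQFnPxAt 𝒞₀` and — for every `κ` with `Kmin ≤ κ.K₀` — the forward
law-carrying root obligation given flatness `RootHoldsNQWFnLKPxAt Lf Kmin 𝒞₀`, the face obligation given flatness and the inner-chain fact at `dT κ.δ₂` (`0 < dT x` for `0 < x`)
`FaceHoldsRNQFnLTKPxAt Lf dT Kmin 𝒞₀`, and the budgeted corridor obligation `ReachHoldsRHNQFnLKPxAt Lf Kmin 𝒞₀`.  Then for every locally finite countable `G` not of exponential growth with a `PlanarSkeletonFrmQuasi Φ`, every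
base vertex `t ∈ Φ.types` with proxies at radius `D` (`Φ.HasProxies t D`), and every `0 < p < 1` with a.s. uniqueness, Φ2 and `θ_t(p) > 0`, some `q < p` has `θ_t(q) > 0`.
(Proof: `drop_of_stepI_outNS_at`, and at each reflected skeleton `Φ.reflect s` — proxies by `HasProxies.reflect` — `outNS_of_residuesNQLTK_at` fed by `𝒞₀` at
`κ := ⟨K₀, δ, δ₂, δr⟩` and the four obligations, the U top's text.) [cite: KozmaNitzan2024, §4 Theorem 6 (pp. 25–31); §1 p. 2] -/
theorem drop_of_choiceFnNQLTKPx_at (Lf : ℕ → ℕ) (dT : ℝ → ℝ) (hdT : ∀ x : ℝ, 0 < x → 0 < dT x) (Kmin : ℕ) {D : ℕ}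
    (𝒞₀ : ChoiceFnNQPxAt D) (hGm : GeomHoldsNQFnPxAt 𝒞₀) (hR : RootHoldsNQWFnLKPxAt Lf Kmin 𝒞₀)
    (hF : FaceHoldsRNQFnLTKPxAt Lf dT Kmin 𝒞₀) (hRe : ReachHoldsRHNQFnLKPxAt Lf Kmin 𝒞₀)
    [DecidableEq V] [Countable V] (Φ : PlanarSkeletonFrmQuasi G) (hg : ¬ HasExponentialGrowth G) {t : V} (ht : t ∈ Φ.types) (hP : Φ.HasProxies t D)
    (p : unitInterval) (hp0 : 0 < (p : ℝ)) (hp1 : (p : ℝ) < 1) (hU : ∀ᵐ ω ∂bondPercolation G p, numInfiniteClusters ω ≤ 1) (hC : Φ.CylSubcritical p)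
    (hθ : 0 < theta G t p) :
    ∃ q : unitInterval, (q : ℝ) < p ∧ 0 < theta G t q := by
  refine drop_of_stepI_outNS_at Φ ht D p hp0 hp1 hU hC hθ fun s => ?_
  -- at the reflected skeleton `Φ.reflect s` (proxies transported), the residue-level step fed by the choice function
  have hCs : (Φ.reflect s).CylSubcritical p := (Φ.reflect_cylSubcritical_iff s p).2 hC
  have hPs : (Φ.reflect s).HasProxies t D := hP.reflect s
  refine outNS_of_residuesNQLTK_at Lf dT hdT Kmin (Φ.reflect s) t D p hp0 hp1 hCs
    fun K₀ δ δ₂ δr hKmin hδ0 hδ1 hδ₂0 hδ₂1 hδr hflat hCF => ?_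
  set κ : Consts := ⟨K₀, δ, δ₂, δr, hδ0, hδ1, hδ₂0, hδ₂1, hδr⟩ with hκ
  have hKmin' : Kmin ≤ κ.K₀ := hKmin
  have hflat' : FlatQ Lf κ := hflat
  have hCF' : ChainFactQT Lf G (Φ.reflect s).Δ κ (dT κ.δ₂) := hCF
  set 𝒞 := 𝒞₀ κ G (Φ.reflect s) hg t ht hPs p hp0 hp1 hCs with h𝒞
  refine ⟨𝒞.δI, 𝒞.m₀, 𝒞.δI_pos, 𝒞.δI_lt_one, fun O hfacts => ?_⟩
  -- the seed floor `max 𝒞.m₀ D` handed by the closure, read down to `𝒞.m₀` for `AtQNQ`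
  have hfacts' : O.FactsNS (G := G) (Φ.reflect s).frame hCs 𝒞.m₀ t := hfacts.of_le (le_max_left _ _)
  obtain ⟨hSz, hSMn⟩ := 𝒞.S_adm O hfacts'
  refine ⟨𝒞.Sz O, 𝒞.SMn O, hSz, hSMn, fun q hq1 hq2 hin hCq => ?_⟩
  have hat : 𝒞.AtQNQ O q := ⟨hfacts', hq1, hq2, hin, hCq⟩
  obtain ⟨hroot, hK, hrun, hanch, hsep, hexit, hsteps, hlev⟩ := hGm κ G (Φ.reflect s) hg t ht hPs p hp0 hp1 hCs O q hat
  obtain ⟨nmax, hnmax, hreach⟩ := hRe κ G (Φ.reflect s) hg t ht hPs p hp0 hp1 hCs hKmin' O q hat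
  exact ⟨𝒞.Γ O q, 𝒞.FD O q, 𝒞.LD O q, hroot, hK, hrun, hanch, hsep, hexit, hsteps, hlev,
    hR κ G (Φ.reflect s) hg t ht hPs p hp0 hp1 hCs hKmin' hflat' O q hat,
    hF κ G (Φ.reflect s) hg t ht hPs p hp0 hp1 hCs hKmin' hflat' hCF' O q hat, nmax, hnmax, hreach⟩

end PlanarSkeletonFrmQuasi

end Summit.CriticalPhenomena.PercolationContinuityZ3.Theorems.Transplant

end
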